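import Mathlib
import HarnessLib
import Summits.ABC.ABC.Theses.CongruentialReceptacle

/-!
# Glue: a tame-local receptacle yields balanced Frey–Szpiro

Item stmt-ABC-14493 of route `route-ABC-CongruentialReceptacle`:
`TameLocalReceptacleGivesTarget : TameLocalReceptacle → BalancedFreySzpiro`.

Proof (the congruence-to-equality reading). Fix `κ, ε` and take `c₁ > 0, c₁', c₃, m₀` from the
receptacle; answer the target with `C := exp (c₃ / c₁)`. For a `κ`-balanced abc-triple put
`N := a * b * c` and `Z := ∑_{p ∣ N} c₁' * (k_p + 1) * log p` with `k_p = v_p a + v_p b + v_p c`;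
the upper window bounds `|∑_p t(p; D_p)| ≤ Z` for EVERY modulus. Choose a prime `ℓ ≥ N + 5`
(so `5 ≤ ℓ`, `ℓ ∤ N`) and `n := m₀ + ⌈2Z⌉₊ + ⌈2c₃⌉₊ + 1 < ℓ ^ n`. The receptacle gives `B`,
`|B| ≤ c₃`, with `∑_p t ≡ B (mod ℓⁿ)`; two integers congruent mod `m` of absolute value `< m/2`
are equal, so `∑_p t = B ≤ c₃`. The lower window summed over `p ∣ N`, together with
`∑_p v_p(N) log p = log N` and `∑_{p ∣ N} log p = log rad(abc)`, gives
`c₁ * (2 log N - (6 + ε) log rad) ≤ c₃`, whence `N² ≤ exp (c₃/c₁) * rad^(6+ε)`.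

The residue arguments of the table and the restriction `ℓ ∤ abc` play no role in the glue. No
literature input; closes `--workitem stmt-ABC-14493`.
-/

-- `Summit.<Summit>.<Problem>` is the mandated summit-side namespace (CONVENTIONS §2); for the
-- single-conjunct summit `ABC` the two coincide, so the duplicate `ABC.ABC` is deliberate.
set_option linter.dupNamespace false

namespace Summit.ABC.ABC.Theorems

open Literature.NumberTheory.DiophantineGeometry

/-- Congruence to equality: two integers congruent modulo `m`, both of absolute value `< m / 2`,
are equal ("the integers are too small to wrap around"). [folklore] -/
theorem congruenceToEquality_of_two_mul_abs_lt {m x y : ℤ} (h : x ≡ y [ZMOD m])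
    (hx : 2 * |x| < m) (hy : 2 * |y| < m) : x = y := by
  have hd : m ∣ x - y := h.symm.dvd
  have habs : |x - y| < m := by
    rw [abs_lt]
    constructor
    · linarith [le_abs_self x, neg_abs_le x, le_abs_self y, neg_abs_le y]
    · linarith [le_abs_self x, neg_abs_le x, le_abs_self y, neg_abs_le y]
  have h0 := Int.eq_zero_of_abs_lt_dvd hd habs
  linarith

/-- **Glue item stmt-ABC-14493.** A tame-local `ℤ/ℓⁿ` receptacle with logarithmic windows,
read at a modulus `ℓⁿ` above the height (congruence = equality), is Szpiro's `6 + ε` for the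
Frey curves of compactly balanced abc-triples in elementary currency:
`TameLocalReceptacle → BalancedFreySzpiro`. [folklore] -/
theorem TameLocalReceptacleGivesTarget_proof :
    Summit.ABC.ABC.Theses.CongruentialReceptacle.TameLocalReceptacleGivesTarget := by
  unfold Summit.ABC.ABC.Theses.CongruentialReceptacle.TameLocalReceptacleGivesTarget
    Summit.ABC.ABC.Theses.CongruentialReceptacle.TameLocalReceptacle
    Summit.ABC.ABC.Theses.CongruentialReceptacle.BalancedFreySzpiro
  intro hT κ hκ ε hε
  obtain ⟨c₁, c₁', c₃, hc₁, m₀, H⟩ := hT κ hκ ε hε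
  refine ⟨Real.exp (c₃ / c₁), ?_⟩
  intro a b c habc ha hb
  have ha0 : a ≠ 0 := Nat.pos_iff_ne_zero.mp habc.1
  have hb0 : b ≠ 0 := Nat.pos_iff_ne_zero.mp habc.2.1
  have hc0 : c ≠ 0 := by
    have := habc.2.2.1
    omega
  -- the height currency `N = abc`
  set N : ℕ := a * b * c with hN
  have hN0 : N ≠ 0 := mul_ne_zero (mul_ne_zero ha0 hb0) hc0
  have hNpos : (0 : ℝ) < (N : ℝ) := by exact_mod_cast Nat.pos_of_ne_zero hN0
  -- the radical is positive
  have hRpos : (0 : ℝ) < ((rad a b c : ℕ) : ℝ) := by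
    have h0 : 0 < rad a b c := by
      rw [rad_def]
      exact Nat.pos_of_ne_zero UniqueFactorizationMonoid.radical_ne_zero
    exact_mod_cast h0
  -- valuations add up: v_p a + v_p b + v_p c = v_p N
  have hfac : ∀ p : ℕ, a.factorization p + b.factorization p + c.factorization p
      = N.factorization p := by
    intro p
    simp only [hN, Nat.factorization_mul (mul_ne_zero ha0 hb0) hc0, Nat.factorization_mul ha0 hb0,
      Finsupp.coe_add, Pi.add_apply]
  -- Σ_p v_p(N) log p = log N and Σ_{p ∣ N} log p = log rad(abc)
  have hlogN : ∑ p ∈ N.primeFactors, ((N.factorization p : ℕ) : ℝ) * Real.log p = Real.log N := by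
    rw [Real.log_nat_eq_sum_factorization, Finsupp.sum, Nat.support_factorization]
  have hlogR : ∑ p ∈ N.primeFactors, Real.log p = Real.log ((rad a b c : ℕ) : ℝ) := by
    rw [rad_def, ← hN, Nat.radical_eq_prod_primeFactors, Nat.cast_prod, Real.log_prod]
    intro p hp
    exact_mod_cast (Nat.prime_of_mem_primeFactors hp).ne_zero
  -- the uniform a-priori bound Z on |Σ_p t(p; D_p)| (independent of the modulus)
  set Z : ℝ := ∑ p ∈ N.primeFactors,
    c₁' * (((a.factorization p + b.factorization p + c.factorization p : ℕ) : ℝ) + 1) * Real.log p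
    with hZ
  -- choose the modulus: a prime ℓ ≥ N + 5 and an exponent n with ℓ ^ n above everything
  obtain ⟨ℓ, hℓge, hℓp⟩ := Nat.exists_infinite_primes (N + 5)
  have h5 : 5 ≤ ℓ := by omega
  have hℓN : ¬ ℓ ∣ N := by
    intro h
    have := Nat.le_of_dvd (Nat.pos_of_ne_zero hN0) h
    omega
  set n : ℕ := m₀ + ⌈2 * Z⌉₊ + ⌈2 * c₃⌉₊ + 1 with hn
  have hnlt : n < ℓ ^ n := Nat.lt_pow_self (by omega)
  have hm₀ : m₀ ≤ ℓ ^ n := by omega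
  have hnR : 2 * Z < (n : ℝ) ∧ 2 * c₃ < (n : ℝ) := by
    rw [hn]
    push_cast
    constructor
    · linarith [Nat.le_ceil (2 * Z), Nat.le_ceil (2 * c₃), (Nat.cast_nonneg m₀ : (0 : ℝ) ≤ m₀),
        (Nat.cast_nonneg ⌈2 * c₃⌉₊ : (0 : ℝ) ≤ ⌈2 * c₃⌉₊)]
    · linarith [Nat.le_ceil (2 * Z), Nat.le_ceil (2 * c₃), (Nat.cast_nonneg m₀ : (0 : ℝ) ≤ m₀),
        (Nat.cast_nonneg ⌈2 * Z⌉₊ : (0 : ℝ) ≤ ⌈2 * Z⌉₊)]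
  have hpowR : (n : ℝ) < ((ℓ ^ n : ℕ) : ℝ) := by exact_mod_cast hnlt
  -- the table at modulus ℓ ^ n and the congruence for our triple
  obtain ⟨t, ht, hB⟩ := H ℓ n hℓp h5 hm₀
  obtain ⟨B, hBle, hcong⟩ := hB a b c habc ha hb hℓN
  set S : ℤ := ∑ p ∈ N.primeFactors, t p (a.factorization p) (b.factorization p) (c.factorization p)
    (a / p ^ a.factorization p % p) (b / p ^ b.factorization p % p) (c / p ^ c.factorization p % p)
    with hS
  -- upper window: |S| ≤ Z
  have hSabs : |(S : ℝ)| ≤ Z := by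
    rw [hS, Int.cast_sum, hZ]
    refine (Finset.abs_sum_le_sum_abs _ _).trans ?_
    exact Finset.sum_le_sum fun p hp => (ht p _ _ _ _ _ _ (Nat.prime_of_mem_primeFactors hp)).2
  -- lower window: c₁ (2 log N - (6 + ε) log rad) ≤ S
  have hSlow : ∑ p ∈ N.primeFactors, c₁ * (2 * ((a.factorization p + b.factorization p
      + c.factorization p : ℕ) : ℝ) - 6 - ε) * Real.log p ≤ (S : ℝ) := by
    rw [hS, Int.cast_sum]
    exact Finset.sum_le_sum fun p hp => (ht p _ _ _ _ _ _ (Nat.prime_of_mem_primeFactors hp)).1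
  have hlow_eq : ∑ p ∈ N.primeFactors, c₁ * (2 * ((a.factorization p + b.factorization p
      + c.factorization p : ℕ) : ℝ) - 6 - ε) * Real.log p
      = c₁ * (2 * Real.log N - (6 + ε) * Real.log ((rad a b c : ℕ) : ℝ)) := by
    rw [← hlogN, ← hlogR, Finset.mul_sum, Finset.mul_sum, ← Finset.sum_sub_distrib, Finset.mul_sum]
    refine Finset.sum_congr rfl fun p _ => ?_
    rw [hfac p]
    ring
  -- congruence to equality: S = B, hence S ≤ c₃
  have hSlt : 2 * |S| < ((ℓ ^ n : ℕ) : ℤ) := by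
    have h : 2 * |(S : ℝ)| < ((ℓ ^ n : ℕ) : ℝ) := by linarith [hnR.1]
    exact_mod_cast h
  have hBlt : 2 * |B| < ((ℓ ^ n : ℕ) : ℤ) := by
    have h : 2 * |(B : ℝ)| < ((ℓ ^ n : ℕ) : ℝ) := by linarith [hnR.2]
    exact_mod_cast h
  have hSB : S = B := congruenceToEquality_of_two_mul_abs_lt hcong hSlt hBlt
  have hSle : (S : ℝ) ≤ c₃ := by
    rw [hSB]
    exact (le_abs_self _).trans hBle
  -- the height inequality 2 log N ≤ (6 + ε) log rad + c₃ / c₁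
  have hkey : c₁ * (2 * Real.log N - (6 + ε) * Real.log ((rad a b c : ℕ) : ℝ)) ≤ c₃ := by
    rw [← hlow_eq]
    exact hSlow.trans hSle
  have hkey' : 2 * Real.log N ≤ (6 + ε) * Real.log ((rad a b c : ℕ) : ℝ) + c₃ / c₁ := by
    have h : 2 * Real.log N - (6 + ε) * Real.log ((rad a b c : ℕ) : ℝ) ≤ c₃ / c₁ := by
      rw [le_div_iff₀ hc₁]
      linarith
    linarith
  -- exponentiate
  have hN2 : ((N : ℕ) : ℝ) ^ 2 = Real.exp (2 * Real.log N) := by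
    rw [show (2 : ℝ) * Real.log N = ((2 : ℕ) : ℝ) * Real.log N by norm_num, Real.exp_nat_mul,
      Real.exp_log hNpos]
  rw [hN2, Real.rpow_def_of_pos hRpos, ← Real.exp_add]
  exact Real.exp_le_exp.mpr (by linarith)

end Summit.ABC.ABC.Theorems
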